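import Literature.AlgebraicGeometry.Resolution.WeightedBlowupInvNoIncrease

/-!
# Translation along a coordinate centre: the transplanted invariant is weakly larger at every point of
# the centre, and where it is equal the centre is the same

The transplant (FW5) and Theorem INV follow the points over the ORIGIN of the coordinate centre
`{x = 0, u_i = 0 (γ_i ≠ 0)}`.  For another point `c` of the centre (`c_i = 0` wherever `γ_i ≠ 0`) the equation
there is `deletePthPowers q (translate c F)` (translation, removal of the constant and of the `q`-th powers), and:

* `WeightedBlowup.exists_support_of_mem_support_translate` — every monomial `u^D` of `translate c F` lies under
  a monomial `u^E` of `F` with `D_i = E_i` at every untranslated variable (`c_i = 0`);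
* `WeightedBlowup.isAdmissibleFor_translate_deletePthPowers` — hence `γ` stays admissible at `c`, so
* `WeightedBlowup.not_lt_centreInvariant_at_centre_point` — the transplanted invariant at `c` is NOT smaller
  than at the origin (observatory PATTERNS C26 (i): `6230/6230`), and
* `WeightedBlowup.centre_eq_at_centre_point_of_max` — if `γ` is still maximal at `c` (the invariant did not jump),
  the maximal admissible coordinate centre at `c` IS `γ` (C26 (ii): `6081/6081`), by the uniqueness theorem
  `eq_of_both_max`; Theorem INV then applies at `c` verbatim.

Where the invariant DOES jump, the translated centre is admissible but not maximal and the invariant can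
increase under its blow-up (kernel row W20, `KangarooAtlasCertWeightedOffOrigin`).  References for the setting
only: [AbramovichTemkinWlodarczyk2024] §5.1; [AbramovichQuekSchober2025] Def. 4.5.
-/

open MvPolynomial Finset

open scoped BigOperators

namespace Literature.AlgebraicGeometry.Resolution

open Literature.AlgebraicGeometry.Resolution.Hauser2010

noncomputable section

namespace WeightedBlowup

variable {σ : Type*} {K : Type*} [CommRing K] [Fintype σ] [DecidableEq σ]

omit [Fintype σ] [DecidableEq σ] in
/-- Translation is additive over the monomial expansion. [folklore] -/
theorem translate_eq_sum_support (c : σ → K) (F : MvPolynomial σ K) :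
    PointBlowup.translate c F = ∑ E ∈ F.support, PointBlowup.translate c (monomial E (coeff E F)) := by
  unfold PointBlowup.translate
  rw [← map_sum]
  congr 1
  exact F.as_sum

/-- **Support of a translate**: every monomial `u^D` of `F(u + c)` lies under some monomial `u^E` of `F`
(`D ≤ E`) with `D_i = E_i` at every untranslated variable (`c_i = 0`). [folklore] -/
theorem exists_support_of_mem_support_translate (c : σ → K) (F : MvPolynomial σ K) (D : σ →₀ ℕ)
    (hD : D ∈ (PointBlowup.translate c F).support) :
    ∃ E ∈ F.support, (∀ i, D i ≤ E i) ∧ ∀ i, c i = 0 → D i = E i := by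
  classical
  rw [MvPolynomial.mem_support_iff, translate_eq_sum_support, coeff_sum] at hD
  obtain ⟨E, hE, hne⟩ := Finset.exists_ne_zero_of_sum_ne_zero hD
  refine ⟨E, hE, fun i => ?_, fun i hci => ?_⟩
  · by_contra h
    push Not at h
    exact hne (coeff_translate_monomial_eq_zero_of_lt c E D (coeff E F) h)
  · by_contra h
    rcases lt_or_gt_of_ne h with hlt | hgt
    · exact hne (coeff_translate_monomial_eq_zero_of_apply_eq_zero c E D (coeff E F) hci hlt)
    · exact hne (coeff_translate_monomial_eq_zero_of_lt c E D (coeff E F) hgt)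

omit [Fintype σ] [DecidableEq σ] in
/-- Deleting `q`-th powers does not enlarge the support. [folklore] -/
theorem mem_support_of_mem_support_deletePthPowers (q : ℕ) (G : MvPolynomial σ K) (D : σ →₀ ℕ)
    (hD : D ∈ (deletePthPowers q G).support) : D ∈ G.support := by
  classical
  rw [MvPolynomial.mem_support_iff, coeff_deletePthPowers] at hD
  rw [MvPolynomial.mem_support_iff]
  by_cases h : IsPthPowerExponent q D
  · simp [h] at hD
  · simpa [h] using hD

/-- **Admissibility persists along the centre**: if `γ ≥ 0` is admissible for `F` and `c` lies on the centre
(`c_i = 0` wherever `γ_i ≠ 0`), then `γ` is admissible for the equation `deletePthPowers q (F(u + c))` at `c`.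
(derived here) [folklore] -/
theorem isAdmissibleFor_translate_deletePthPowers (q : ℕ) (γ : σ → ℚ) (c : σ → K)
    (hc : ∀ i, γ i ≠ 0 → c i = 0) (F : MvPolynomial σ K) (hadm : IsAdmissibleFor γ F) :
    IsAdmissibleFor γ (deletePthPowers q (PointBlowup.translate c F)) := by
  classical
  intro D hD
  obtain ⟨E, hE, -, heq⟩ := exists_support_of_mem_support_translate c F D
    (mem_support_of_mem_support_deletePthPowers q _ D hD)
  have : monomialValuation γ D = monomialValuation γ E := by
    unfold monomialValuation
    rw [Finsupp.sum_fintype _ _ (fun i => by simp), Finsupp.sum_fintype _ _ (fun i => by simp)]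
    refine Finset.sum_congr rfl fun i _ => ?_
    by_cases hγ : γ i = 0
    · simp [hγ]
    · rw [heq i (hc i hγ)]
  rw [this]
  exact hadm E hE

/-- **The transplanted invariant is weakly larger at every point of the centre** (PATTERNS C26 (i)): if `γ_c`
is the maximal admissible nonnegative coordinate cocharacter at `c`, its invariant is not below that of `γ`.
(derived here) [folklore] -/
theorem not_lt_centreInvariant_at_centre_point (q : ℕ) (γ γc : σ → ℚ) (c : σ → K) (F : MvPolynomial σ K)
    (hγ0 : ∀ i, 0 ≤ γ i) (hadm : IsAdmissibleFor γ F) (hc : ∀ i, γ i ≠ 0 → c i = 0)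
    (hmaxc : ∀ γ' : σ → ℚ, (∀ i, 0 ≤ γ' i) →
      IsAdmissibleFor γ' (deletePthPowers q (PointBlowup.translate c F)) →
      ¬ ATW.TruncLex.lt (centreInvariant q γc) (centreInvariant q γ')) :
    ¬ ATW.TruncLex.lt (centreInvariant q γc) (centreInvariant q γ) :=
  hmaxc γ hγ0 (isAdmissibleFor_translate_deletePthPowers q γ c hc F hadm)

/-- **Equal invariant ⇒ same centre** (PATTERNS C26 (ii)): if `γ` (maximal at the origin or not) is ALSO
maximal at the point `c` of its centre — no admissible cocharacter at `c` beats it — then the maximal admissible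
nonnegative cocharacter `γ_c` at `c` equals `γ`; Theorem INV (`not_invCoordIncreases`) then applies at `c`.
(derived here) [folklore] -/
theorem centre_eq_at_centre_point_of_max (q : ℕ) (γ γc : σ → ℚ) (c : σ → K) (F : MvPolynomial σ K)
    (hγ0 : ∀ i, 0 ≤ γ i) (hγc0 : ∀ i, 0 ≤ γc i) (hadm : IsAdmissibleFor γ F)
    (hc : ∀ i, γ i ≠ 0 → c i = 0)
    (hadmc : IsAdmissibleFor γc (deletePthPowers q (PointBlowup.translate c F)))
    (hmaxc : ∀ γ' : σ → ℚ, (∀ i, 0 ≤ γ' i) →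
      IsAdmissibleFor γ' (deletePthPowers q (PointBlowup.translate c F)) →
      ¬ ATW.TruncLex.lt (centreInvariant q γc) (centreInvariant q γ'))
    (hmax : ∀ γ' : σ → ℚ, (∀ i, 0 ≤ γ' i) →
      IsAdmissibleFor γ' (deletePthPowers q (PointBlowup.translate c F)) →
      ¬ ATW.TruncLex.lt (centreInvariant q γ) (centreInvariant q γ')) :
    γc = γ := by
  refine eq_of_both_max (deletePthPowers q (PointBlowup.translate c F)) γc γ hγc0 hγ0 hadmc
    (isAdmissibleFor_translate_deletePthPowers q γ c hc F hadm) ?_ ?_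
  · intro γ' h0 h'
    rw [← centreInvariant_lt_iff q]
    exact hmaxc γ' h0 h'
  · intro γ' h0 h'
    rw [← centreInvariant_lt_iff q]
    exact hmax γ' h0 h'

end WeightedBlowup

end

end Literature.AlgebraicGeometry.Resolution
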